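import Summits.MatrixMultiplication.MatrixMultiplication.Theorems.FarEdgeDescentCarrierGeometry
import HarnessLib

/-!
# Route `FarEdgeDescent` — Kernel XXII-E «the carrier path: from the top corner to the light corner»

decomp-mm ROOT cell (D-0178), lens 2 «structural dichotomy: special vs generic», gen 46; Theses-free
(imports XXII-D and through it XXI/XXII and `Literature` only; every field `K`; unconditional except §5).
Cut of record UNCHANGED.  Notation: `θ = specMMPoint K φ`, darkness `d(φ) = Σθ − 2`, depth `ε(φ) = 1 − θ₂`,
`e(x) = ω_K(1,x,1) − (x+1)`, `τ = ω_K − 2`, `σ_K` = the minimal top depth (attained, XXII-B), `φ` CARRIES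
`x` iff `θ₁ + xθ₂ + θ₃ = ω_K(1,x,1)` (top points = carriers of `x = 1`; carriers exist for all `x ≥ 0`).

THE PICTURE THIS FILE TYPES (every field, no hypothesis).  Order the carriers by the format they carry.
§1 EXCHANGE MONOTONICITY (`carrier_exchange`): if `φ` carries `x` and `ψ` carries `y` with `0 ≤ x < y`,
   then `θ₂(φ) ≤ θ₂(ψ)` (carriers get SHALLOWER as the format grows) and
   `(x−1)(θ₂(ψ) − θ₂(φ)) ≤ Σθ(φ) − Σθ(ψ) ≤ (y−1)(θ₂(ψ) − θ₂(φ))`; for `x ≥ 1` they also get LIGHTER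
   (`carrier_darkness_anti`).  Band separation (XXII-D) is the case `x = 1`.
§2 THE TOP END IS ONE SHADOW POINT (`nearTop_height_lt`, Cantor intersection in the compact spectrum,
   Zuiddam Thm. 2.15): for every `η > 0` there is `δ > 0` such that every universal point with
   `Σθ ≥ ω_K − δ` has `θ₂ < (1 − σ_K) + η` — near-top points are nearly as deep as the shallowest top
   point; hence (`carriers_near_square`) carriers of formats `x ∈ (1, 1+δ)` satisfy
   `1 − σ_K ≤ θ₂ < 1 − σ_K + η` and `ω_K − η < Σθ ≤ ω_K`: in the shadow plane `(ε, d)` ALL carriers converge,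
   as `x → 1⁺`, to the single point `P_K = (σ_K, τ)` — the corner of the top band.  The carrying band
   (special) and the top band (generic) of XXII-D touch at exactly this point.
§3 THE FAR END IS THE LIGHT CORNER (`carrier_near_lightCorner`, from the every-field log rate): a carrier
   of a format `x ≥ 2k`, `k ≥ 1`, has `ε ≤ 9/(x·log(k+2))` and `d ≤ 27/(2·log(k+2))` — carriers tend to
   `(0,0)` as `x → ∞`.
§4 THE TWO LEAVES ON THE PATH: the special leaf's shape `FS_K ⟺` the path REACHES the light corner at a
   finite format (`fsShape_iff_nonDark_carrier`: some `x > 1` has a non-dark — equivalently light —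
   carrier, e.g. the flattening point `ζ⁽²⁾`); the generic leaf with `ω_K > 2` makes the path LEAVE the top
   corner at once (`carrier_nonTop_of_alc`, XXII-D); the summit is «the path is the single point `(0,0)`»
   (`omega_eq_two_iff_carriers_light`, XXII-D).
§5 UNDER THE GENERIC ITEM THE PATH LEAVES `P_K` AT LINEAR SPEED (`carrier_depth_deficit_of_alc`): with
   `ω_K > 2`, a carrier of `x > 1` has `ε(G) − ε ≥ (x−1)ε(G)²/(2τ) − (x−1)²ε(G)³/(6τ²)` for every top `G` —
   the carrier-side form of bluntness (XXII-C), a quantitative band separation.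
So the carriers trace a MONOTONE PATH in the shadow from `P_K = (σ_K, τ)` down to `(0,0)`; the special leaf
and its ladder (XXII-A) are the regularity of this path at its far end, the generic leaf (XXI-B/C, XXII-B/C/D)
is its bluntness at the near end, and the summit over `K` is `P_K = (0,0)` (`omega_eq_two_iff_corner`).

NO definitions (gate rule D-0009).  Nothing here proves `ω = 2`.
References: [cite: Strassen1988, Thm. 3.8]; [cite: Zuiddam2018, Thm. 2.15, Cor. 2.13];
[cite: AlmanLi2026, Proposition 4.1, Proposition 4.2]; [cite: LottiRomani1983, Prop. 4.1];
[cite: ChristandlVranaZuiddam2023, §1.2].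
-/

set_option linter.dupNamespace false

noncomputable section

open scoped BigOperators

namespace Summit.MatrixMultiplication.MatrixMultiplication.Theorems.FarEdgeDescentCarrierPath

open Literature.Computability.AlgebraicComplexity
open Summit.MatrixMultiplication.MatrixMultiplication.Theorems.FarEdgeDescentSpectralShadow
open Summit.MatrixMultiplication.MatrixMultiplication.Theorems.FarEdgeDescentSpectralHorn
open Summit.MatrixMultiplication.MatrixMultiplication.Theorems.FarEdgeDescentFieldNode
open Summit.MatrixMultiplication.MatrixMultiplication.Theorems.FarEdgeDescentSpectralAbundance
open Summit.MatrixMultiplication.MatrixMultiplication.Theorems.FarEdgeDescentExitSlope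
open Summit.MatrixMultiplication.MatrixMultiplication.Theorems.FarEdgeDescentConeDial
open Summit.MatrixMultiplication.MatrixMultiplication.Theorems.FarEdgeDescentCarrierGeometry

variable {K : Type} [Field K]

/-! ## §1 Exchange monotonicity of carriers -/

/-- **Carrier exchange** (every field, unconditional): if `φ` carries `x` and `ψ` carries `y`,
`0 ≤ x < y`, then `θ₂(φ) ≤ θ₂(ψ)` and `(x−1)(θ₂(ψ)−θ₂(φ)) ≤ Σθ(φ) − Σθ(ψ) ≤ (y−1)(θ₂(ψ)−θ₂(φ))`
(each support line lies below the pencil at the other format). [cite: Strassen1988, Thm. 3.8] -/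
theorem carrier_exchange {F G : SpectralMap K} (hF : IsUniversalSpectralPoint K F)
    (hG : IsUniversalSpectralPoint K G) {x y : ℝ} (hx : 0 ≤ x) (hxy : x < y)
    (hcarF : specMMPoint K F 0 + x * specMMPoint K F 1 + specMMPoint K F 2 = omegaRect K 1 x 1)
    (hcarG : specMMPoint K G 0 + y * specMMPoint K G 1 + specMMPoint K G 2 = omegaRect K 1 y 1) :
    specMMPoint K F 1 ≤ specMMPoint K G 1 ∧
      (x - 1) * (specMMPoint K G 1 - specMMPoint K F 1) ≤
          (∑ i, specMMPoint K F i) - ∑ i, specMMPoint K G i ∧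
        (∑ i, specMMPoint K F i) - ∑ i, specMMPoint K G i ≤
          (y - 1) * (specMMPoint K G 1 - specMMPoint K F 1) := by
  have h1 := line_le_omegaRect hG hx
  have h2 := line_le_omegaRect hF (by linarith : (0 : ℝ) ≤ y)
  rw [← hcarF] at h1
  rw [← hcarG] at h2
  rw [sum_three, sum_three]
  have hmul : (y - x) * specMMPoint K F 1 ≤ (y - x) * specMMPoint K G 1 := by linarith
  refine ⟨?_, by linarith, by linarith⟩
  by_contra hlt
  push Not at hlt
  have := mul_lt_mul_of_pos_left hlt (by linarith : (0 : ℝ) < y - x)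
  linarith

/-- **Carriers get lighter as the format grows past the square**: `1 ≤ x < y`, `φ` carries `x`,
`ψ` carries `y` ⟹ `Σθ(ψ) ≤ Σθ(φ)`. [cite: Strassen1988, Thm. 3.8] -/
theorem carrier_darkness_anti {F G : SpectralMap K} (hF : IsUniversalSpectralPoint K F)
    (hG : IsUniversalSpectralPoint K G) {x y : ℝ} (hx : 1 ≤ x) (hxy : x < y)
    (hcarF : specMMPoint K F 0 + x * specMMPoint K F 1 + specMMPoint K F 2 = omegaRect K 1 x 1)
    (hcarG : specMMPoint K G 0 + y * specMMPoint K G 1 + specMMPoint K G 2 = omegaRect K 1 y 1) :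
    (∑ i, specMMPoint K G i) ≤ ∑ i, specMMPoint K F i := by
  obtain ⟨hθ, hlow, -⟩ := carrier_exchange hF hG (by linarith) hxy hcarF hcarG
  nlinarith [mul_nonneg (by linarith : (0 : ℝ) ≤ x - 1) (sub_nonneg.2 hθ)]

/-! ## §2 The top end of the path is the single shadow point `(σ_K, τ)` -/

/-- **Near-top points are nearly as deep as the shallowest top point** (every field, unconditional):
if `s` bounds the height `θ₂` of every top point, then for every `η > 0` there is `δ > 0` such that every
universal point with `Σθ ≥ ω_K − δ` has `θ₂ < s + η`.  (Otherwise the closed sets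
`{φ ∈ X : φ[⟨1,2,1⟩] ≥ 2^{s+η}, φ[⟨2,2,2⟩] ≥ 2^{ω−1/(n+1)}}` of the compact spectrum are nested and
nonempty, and Cantor intersection yields a top point of height `≥ s + η`.)
[cite: Zuiddam2018, Thm. 2.15, Cor. 2.13] [cite: AlmanLi2026, Proposition 4.2] -/
theorem nearTop_height_lt {s : ℝ}
    (hmax : ∀ G : SpectralMap K, IsUniversalSpectralPoint K G → ∑ i, specMMPoint K G i = omega K →
      specMMPoint K G 1 ≤ s)
    {η : ℝ} (hη : 0 < η) :
    ∃ δ : ℝ, 0 < δ ∧ ∀ G : SpectralMap K, IsUniversalSpectralPoint K G →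
      omega K - δ ≤ ∑ i, specMMPoint K G i → specMMPoint K G 1 < s + η := by
  by_contra hnot
  push Not at hnot
  set X := {φ : TensorClass K → ℝ | IsSpectralPoint (fun x y : TensorClass K => x ≤ y) φ} with hXdef
  have hX : IsCompact X := (TensorClass.isStrassenPreorder K).isCompact_setOf_isSpectralPoint
  set c := TensorClass.mk (matMulTensor K 2 2 2) with hc
  set a := TensorClass.mk (matMulTensor K 1 2 1) with ha
  set V : ℕ → Set (TensorClass K → ℝ) := fun n =>
    X ∩ ({φ | (2 : ℝ) ^ (s + η) ≤ φ a} ∩ {φ | (2 : ℝ) ^ (omega K - 1 / ((n : ℝ) + 1)) ≤ φ c}) with hV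
  have hVcl : ∀ n, IsClosed (V n) := fun n =>
    hX.isClosed.inter ((isClosed_le continuous_const (continuous_apply a)).inter
      (isClosed_le continuous_const (continuous_apply c)))
  have hVmono : ∀ n, V (n + 1) ⊆ V n := by
    intro n φ hφ
    have h3 : (2 : ℝ) ^ (omega K - 1 / (((n + 1 : ℕ) : ℝ) + 1)) ≤ φ c := hφ.2.2
    refine ⟨hφ.1, hφ.2.1, ?_⟩
    show (2 : ℝ) ^ (omega K - 1 / ((n : ℝ) + 1)) ≤ φ c
    refine le_trans (Real.rpow_le_rpow_of_exponent_le one_le_two ?_) h3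
    push_cast
    have h1 : (1 : ℝ) / ((n : ℝ) + 1 + 1) ≤ 1 / ((n : ℝ) + 1) :=
      one_div_le_one_div_of_le (by positivity) (by linarith)
    linarith
  -- each `V n` is nonempty: a bad near-top point at `δ = 1/(n+1)`
  have hVne : ∀ n, (V n).Nonempty := by
    intro n
    have hn1 : (0 : ℝ) < 1 / ((n : ℝ) + 1) := by positivity
    obtain ⟨G, hG, hdark, hheight⟩ := hnot (1 / ((n : ℝ) + 1)) hn1
    rw [sum_three] at hdark
    refine ⟨TensorClass.eval G, TensorClass.isSpectralPoint_eval hG, ?_, ?_⟩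
    · show (2 : ℝ) ^ (s + η) ≤ TensorClass.eval G a
      rw [ha, TensorClass.eval_mk hG, hG.map_matMulTensor_line₂ (by norm_num : 1 ≤ 2), Nat.cast_ofNat]
      exact Real.rpow_le_rpow_of_exponent_le one_le_two hheight
    · show (2 : ℝ) ^ (omega K - 1 / ((n : ℝ) + 1)) ≤ TensorClass.eval G c
      rw [hc, TensorClass.eval_mk hG, hG.map_matMulTensor_cube (by norm_num : 1 ≤ 2), Nat.cast_ofNat,
        sum_three]
      exact Real.rpow_le_rpow_of_exponent_le one_le_two hdark
  have hV0 : IsCompact (V 0) := hX.inter_right ((isClosed_le continuous_const (continuous_apply a)).inter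
      (isClosed_le continuous_const (continuous_apply c)))
  obtain ⟨φ, hφ⟩ := IsCompact.nonempty_iInter_of_sequence_nonempty_isCompact_isClosed V hVmono hVne hV0 hVcl
  rw [Set.mem_iInter] at hφ
  have hφX : φ ∈ X := (hφ 0).1
  have hψ := TensorClass.isUniversalSpectralPoint_spectralMapOf hφX
  set G := TensorClass.spectralMapOf φ with hGdef
  have hGa : G (matMulTensor K 1 2 1) = φ a := by rw [hGdef, TensorClass.spectralMapOf_apply]
  have hGc : G (matMulTensor K 2 2 2) = φ c := by rw [hGdef, TensorClass.spectralMapOf_apply]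
  have hsumle := AlmanLi2026.prop42_sum_le_omega hψ
  have htopG : ∑ i, specMMPoint K G i = omega K := by
    refine le_antisymm hsumle (le_of_forall_pos_lt_add fun δ hδ => ?_)
    obtain ⟨n, hn⟩ := exists_nat_one_div_lt hδ
    have h2 : (2 : ℝ) ^ (omega K - 1 / ((n : ℝ) + 1)) ≤ φ c := (hφ n).2.2
    rw [← hGc, hψ.map_matMulTensor_cube (by norm_num : 1 ≤ 2), Nat.cast_ofNat,
      Real.rpow_le_rpow_left_iff one_lt_two] at h2
    linarith
  have hha : (2 : ℝ) ^ (s + η) ≤ φ a := (hφ 0).2.1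
  rw [← hGa, hψ.map_matMulTensor_line₂ (by norm_num : 1 ≤ 2), Nat.cast_ofNat,
    Real.rpow_le_rpow_left_iff one_lt_two] at hha
  have := hmax G hψ htopG
  linarith

/-- **All carriers converge to the corner `P_K = (σ_K, τ)` of the top band as the format tends to the
square** (every field, unconditional): with `s = 1 − σ_K` the attained maximal top height, for every
`η > 0` there is `δ > 0` such that every carrier `φ` of a format `x ∈ (1, 1+δ)` has
`s ≤ θ₂(φ) < s + η` and `ω_K − η < Σθ(φ) ≤ ω_K`. [cite: Zuiddam2018, Thm. 2.15] [cite: Strassen1988, Thm. 3.8] -/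
theorem carriers_near_square {G₀ : SpectralMap K} (hG₀ : IsUniversalSpectralPoint K G₀)
    (htop₀ : ∑ i, specMMPoint K G₀ i = omega K)
    (hmax : ∀ G : SpectralMap K, IsUniversalSpectralPoint K G → ∑ i, specMMPoint K G i = omega K →
      specMMPoint K G 1 ≤ specMMPoint K G₀ 1)
    {η : ℝ} (hη : 0 < η) :
    ∃ δ : ℝ, 0 < δ ∧ ∀ F : SpectralMap K, IsUniversalSpectralPoint K F → ∀ x : ℝ, 1 < x → x < 1 + δ →
      specMMPoint K F 0 + x * specMMPoint K F 1 + specMMPoint K F 2 = omegaRect K 1 x 1 →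
        (specMMPoint K G₀ 1 ≤ specMMPoint K F 1 ∧ specMMPoint K F 1 < specMMPoint K G₀ 1 + η) ∧
          (omega K - η < ∑ i, specMMPoint K F i ∧ (∑ i, specMMPoint K F i) ≤ omega K) := by
  obtain ⟨δ₁, hδ₁, hnear⟩ := nearTop_height_lt hmax hη
  refine ⟨min δ₁ η / 2, by positivity, fun F hF x hx hxδ hcar => ?_⟩
  obtain ⟨hband, hdark⟩ := carrier_shallower_than_top hG₀ htop₀ hF hx hcar
  have hsum := AlmanLi2026.prop42_sum_le_omega hF
  have hθ1 : specMMPoint K F 1 ≤ 1 := (AlmanLi2026.prop42_mem_Icc hF 1).2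
  have hθ0 : 0 ≤ specMMPoint K G₀ 1 := (AlmanLi2026.prop42_mem_Icc hG₀ 1).1
  have hmin1 : min δ₁ η ≤ δ₁ := min_le_left _ _
  have hmin2 : min δ₁ η ≤ η := min_le_right _ _
  -- darkness deficit `≤ (x−1)(θ₂(F) − θ₂(G₀)) ≤ (x−1) < δ`
  have hdef : omega K - (x - 1) ≤ ∑ i, specMMPoint K F i := by
    have : (x - 1) * (specMMPoint K F 1 - specMMPoint K G₀ 1) ≤ (x - 1) * 1 :=
      mul_le_mul_of_nonneg_left (by linarith) (by linarith)
    linarith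
  refine ⟨⟨hband, hnear F hF (by linarith)⟩, by linarith, hsum⟩

/-- **The summit over `K` is `P_K = (0,0)`**: `ω_K = 2` iff the shallowest top point is light iff it is
not dark — both coordinates of the corner vanish together (XXII-C `tangentInvariants`).
[cite: LottiRomani1983, Prop. 4.1] [cite: AlmanLi2026, Proposition 4.2] -/
theorem omega_eq_two_iff_corner {G₀ : SpectralMap K} (hG₀ : IsUniversalSpectralPoint K G₀)
    (htop₀ : ∑ i, specMMPoint K G₀ i = omega K)
    (hmax : ∀ G : SpectralMap K, IsUniversalSpectralPoint K G → ∑ i, specMMPoint K G i = omega K →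
      specMMPoint K G 1 ≤ specMMPoint K G₀ 1) :
    (omega K = 2 ↔ specMMPoint K G₀ 1 = 1) ∧ (omega K = 2 ↔ ∑ i, specMMPoint K G₀ i = 2) := by
  refine ⟨⟨fun h2 => ?_, fun h1 => ?_⟩, ⟨fun h2 => by rw [htop₀, h2], fun h => by rw [← htop₀, h]⟩⟩
  · -- `ω_K = 2`: the carrier of `x = 2` is light and top points are at most as high... use the face criterion
    obtain ⟨F, hF, htopF, hF1⟩ := (omega_eq_two_iff_top_on_face (K := K)).1 h2
    have := hmax F hF htopF
    have hle : specMMPoint K G₀ 1 ≤ 1 := (AlmanLi2026.prop42_mem_Icc hG₀ 1).2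
    linarith
  · have hl := light_of_coord_eq_one hG₀ 1 h1
    rw [htop₀] at hl
    exact hl

/-! ## §3 The far end of the path is the light corner `(0,0)` -/

/-- **Carriers of large formats hug the light corner** (every field, unconditional): a carrier `φ` of a
format `x ≥ 2k`, `k ≥ 1`, has depth `ε(φ) ≤ 9/(x·log(k+2))` and darkness `d(φ) ≤ 27/(2·log(k+2))`
(`depth_le_of_carrier` with `x − k ≥ x/2`, and `d = e(x) + (x−1)ε` with the log rate `e(k) ≤ 9/(2log(k+2))`).
[cite: LottiRomani1983, Prop. 4.1] [cite: Coppersmith1982, Thm. 1] -/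
theorem carrier_near_lightCorner {F : SpectralMap K} (hF : IsUniversalSpectralPoint K F) {x : ℝ} {k : ℕ}
    (hk : 1 ≤ k) (hxk : 2 * (k : ℝ) ≤ x)
    (hcar : specMMPoint K F 0 + x * specMMPoint K F 1 + specMMPoint K F 2 = omegaRect K 1 x 1) :
    1 - specMMPoint K F 1 ≤ 9 / (x * Real.log ((k : ℝ) + 2)) ∧
      (∑ i, specMMPoint K F i) - 2 ≤ 27 / (2 * Real.log ((k : ℝ) + 2)) := by
  have hk1 : (1 : ℝ) ≤ k := by exact_mod_cast hk
  have hx : 2 ≤ x := by linarith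
  have hlog : 0 < Real.log ((k : ℝ) + 2) := Real.log_pos (by linarith)
  have hdepth := depth_le_of_carrier hF k hcar
  have hε : 0 ≤ 1 - specMMPoint K F 1 := by linarith [(AlmanLi2026.prop42_mem_Icc hF 1).2]
  -- depth: `(x−k)ε ≤ 9/(2 log(k+2))` and `x − k ≥ x/2`
  have hxk' : x / 2 ≤ x - k := by linarith
  have h1 : x / 2 * (1 - specMMPoint K F 1) ≤ 9 / (2 * Real.log ((k : ℝ) + 2)) :=
    (mul_le_mul_of_nonneg_right hxk' hε).trans hdepth
  have hεb : 1 - specMMPoint K F 1 ≤ 9 / (x * Real.log ((k : ℝ) + 2)) := by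
    rw [le_div_iff₀ (by positivity)]
    rw [le_div_iff₀ (by positivity)] at h1
    nlinarith
  refine ⟨hεb, ?_⟩
  -- darkness: `d = e(x) + (x−1)ε ≤ e(k) + 2·(x−k)ε`... via the excess at the integer `k ≤ x`
  have hanti : omegaRect K 1 x 1 - x ≤ omegaRect K 1 k 1 - k :=
    omegaRect_one_mid_one_sub_antitone K (show (k : ℝ) ≤ x by linarith)
  have hek := excess_le_log (K := K) k
  rw [sum_three]
  -- `(x−1)ε ≤ 2(x−k)ε ≤ 9/log(k+2)`
  have h2 : (x - 1) * (1 - specMMPoint K F 1) ≤ 2 * ((x - k) * (1 - specMMPoint K F 1)) := by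
    nlinarith
  have h3 : 2 * ((x - k) * (1 - specMMPoint K F 1)) ≤ 9 / Real.log ((k : ℝ) + 2) := by
    have := mul_le_mul_of_nonneg_left hdepth (by norm_num : (0 : ℝ) ≤ 2)
    calc 2 * ((x - k) * (1 - specMMPoint K F 1)) ≤ 2 * (9 / (2 * Real.log ((k : ℝ) + 2))) := this
      _ = 9 / Real.log ((k : ℝ) + 2) := by field_simp
  have hd : specMMPoint K F 0 + specMMPoint K F 1 + specMMPoint K F 2 - 2 =
      (omegaRect K 1 x 1 - (x + 1)) + (x - 1) * (1 - specMMPoint K F 1) := by rw [← hcar]; ring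
  rw [hd]
  have h27 : 9 / (2 * Real.log ((k : ℝ) + 2)) + 9 / Real.log ((k : ℝ) + 2) =
      27 / (2 * Real.log ((k : ℝ) + 2)) := by
    field_simp; ring
  linarith [h27]

/-- **The special leaf's shape: the path REACHES the light corner at a finite format** (every field):
`(∃ k ≥ 2, ω_K(1,k,1) = k+1) ⟺` some format `x > 1` has a carrier that is not dark (`Σθ = 2`;
equivalently light).  (`⟹`: the flattening point `ζ⁽²⁾` carries `k`, XXII-D; `⟸`: a non-dark carrier of
`x` gives `e(x) = 0`, hence `e(⌈x⌉) = 0`.)  Compare the generic leaf: under `ALC_K` with `ω_K > 2` the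
path LEAVES the top corner at once (`carrier_nonTop_of_alc`, XXII-D). [cite: LottiRomani1983, Prop. 4.1]
[cite: ChristandlVranaZuiddam2023, Example 1.4] -/
theorem fsShape_iff_nonDark_carrier :
    (∃ k : ℕ, 2 ≤ k ∧ omegaRect K 1 k 1 = k + 1) ↔
      ∃ x : ℝ, 1 < x ∧ ∃ F : SpectralMap K, IsUniversalSpectralPoint K F ∧
        specMMPoint K F 0 + x * specMMPoint K F 1 + specMMPoint K F 2 = omegaRect K 1 x 1 ∧
          ∑ i, specMMPoint K F i = 2 := by
  constructor
  · rintro ⟨k, hk, hsat⟩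
    have hk2 : (2 : ℝ) ≤ k := by exact_mod_cast hk
    have hl := light_of_coord_eq_one (gaugePoint₂_isUniversalSpectralPoint K) 1 (gaugePoint₂_light (K := K))
    exact ⟨k, by linarith, gaugePoint₂ K, gaugePoint₂_isUniversalSpectralPoint K,
      (gaugePoint₂_carries_iff (K := K) k).2 hsat, hl⟩
  · rintro ⟨x, hx, F, hF, hcar, h2⟩
    rw [sum_three] at h2
    have hθ1 : specMMPoint K F 1 ≤ 1 := (AlmanLi2026.prop42_mem_Icc hF 1).2
    -- `e(x) = 0`
    have hex : omegaRect K 1 x 1 ≤ x + 1 := by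
      rw [← hcar]
      nlinarith [mul_le_mul_of_nonneg_left hθ1 (by linarith : (0 : ℝ) ≤ x - 1)]
    refine ⟨⌈x⌉₊, ?_, le_antisymm ?_ (add_one_le_omegaRect_one_mid_one K _)⟩
    · have h := Nat.le_ceil x
      have : (2 : ℝ) ≤ ⌈x⌉₊ := by
        have h2 : (1 : ℝ) < ⌈x⌉₊ := lt_of_lt_of_le hx h
        have h3 : (1 : ℕ) < ⌈x⌉₊ := by exact_mod_cast h2
        exact_mod_cast h3
      exact_mod_cast this
    · have hanti : omegaRect K 1 (⌈x⌉₊ : ℝ) 1 - ⌈x⌉₊ ≤ omegaRect K 1 x 1 - x :=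
        omegaRect_one_mid_one_sub_antitone K (Nat.le_ceil x)
      linarith

/-! ## §5 Under the generic item the path leaves `P_K` at linear speed -/

/-- **Carrier-side bluntness** (every field; under the text of `AnchoredLogConvexity` over `K` with
`ω_K > 2`): a carrier `φ` of a format `x > 1` is STRICTLY shallower than every top point `G`, by
`ε(G) − ε(φ) ≥ (x−1)·ε(G)²/(2τ) − (x−1)²·ε(G)³/(6τ²)` — the blunt parabola of XXII-C at `G` lies below
`e(x) = d(φ) − (x−1)ε(φ) ≤ τ − (x−1)ε(φ)`.  Quantitative band separation: near the square the carrying band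
stays below the level `ε = σ_K` by a margin linear in `x − 1` (unconditionally only `ε(φ) ≤ σ_K`, XXII-D).
[cite: LottiRomani1983, Prop. 4.1] [cite: Strassen1988, Thm. 3.8] -/
theorem carrier_depth_deficit_of_alc
    (hA : ∀ m : ℝ, 1 < m →
      (omegaRect K 1 m 1 - (m + 1)) ^ 2 ≤ (omegaRect K 1 1 1 - 2) * (omegaRect K 1 (2 * m - 1) 1 - 2 * m))
    (hω : 2 < omega K) {G F : SpectralMap K} (hG : IsUniversalSpectralPoint K G)
    (htop : ∑ i, specMMPoint K G i = omega K) (hF : IsUniversalSpectralPoint K F) {x : ℝ} (hx : 1 < x)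
    (hcar : specMMPoint K F 0 + x * specMMPoint K F 1 + specMMPoint K F 2 = omegaRect K 1 x 1) :
    (x - 1) * (1 - specMMPoint K G 1) ^ 2 / (2 * (omega K - 2)) -
        (x - 1) ^ 2 * (1 - specMMPoint K G 1) ^ 3 / (6 * (omega K - 2) ^ 2) ≤
      (1 - specMMPoint K G 1) - (1 - specMMPoint K F 1) := by
  have hblunt := excess_ge_bluntParabola hA hω hG htop hx.le
  have hsum := AlmanLi2026.prop42_sum_le_omega hF
  rw [sum_three] at hsum
  rw [← hcar] at hblunt
  have hpos : 0 < x - 1 := by linarith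
  -- `(x−1)ε(φ) ≤ (x−1)ε(G) − (x−1)²ε(G)²/(2τ) + (x−1)³ε(G)³/(6τ²)`
  have key : (x - 1) * (1 - specMMPoint K F 1) ≤ (x - 1) * (1 - specMMPoint K G 1) -
      (x - 1) ^ 2 * (1 - specMMPoint K G 1) ^ 2 / (2 * (omega K - 2)) +
      (x - 1) ^ 3 * (1 - specMMPoint K G 1) ^ 3 / (6 * (omega K - 2) ^ 2) := by
    linarith
  refine le_of_mul_le_mul_left ?_ hpos
  have e1 : (x - 1) * ((x - 1) * (1 - specMMPoint K G 1) ^ 2 / (2 * (omega K - 2)) -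
      (x - 1) ^ 2 * (1 - specMMPoint K G 1) ^ 3 / (6 * (omega K - 2) ^ 2)) =
      (x - 1) ^ 2 * (1 - specMMPoint K G 1) ^ 2 / (2 * (omega K - 2)) -
      (x - 1) ^ 3 * (1 - specMMPoint K G 1) ^ 3 / (6 * (omega K - 2) ^ 2) := by ring
  have e2 : (x - 1) * ((1 - specMMPoint K G 1) - (1 - specMMPoint K F 1)) =
      (x - 1) * (1 - specMMPoint K G 1) - (x - 1) * (1 - specMMPoint K F 1) := by ring
  rw [e1, e2]
  linarith

end Summit.MatrixMultiplication.MatrixMultiplication.Theorems.FarEdgeDescentCarrierPath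

end
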